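import Summits.Ventures.CertifiedManyBodySolver.Downfold.EmeryScaleLeverFIPath
import Summits.Ventures.CertifiedManyBodySolver.Downfold.EmeryScaleLeverSteps
import HarnessLib

/-!
# THE BOX CHECKER OF THE SCALE COORDINATE: adaptive bisection of fixed-point boxes over the two leaf tests, and the soundness of one corner-anchored
# lever CELL (anchor family × step cell) — UPPER and LOWER (INFL-3to1-B §B.88 (n)–(p))

Venture CertifiedManyBodySolver, cell `pub/hubbard-downfold` (stage S1; INFLATION-RULES-3to1-B §B.88), seat hubbard-downfold-mod-4 (technique B = band
level, g36); namespace `Summit.Ventures.CertifiedManyBodySolver.Downfold.Emery`. Everything PROVED (0 sorry). WHAT THIS IS NOT: a statement about any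
material; no number lives here; `U = 0` one-body kinematics of the σ model.

* §1 `SBox` (five FI coordinates: `Δ, a, b` of the anchor row, the step `s`, the energy `e`), `SBox.mem`, halving along a coordinate (`SBox.left/right`,
  `SBox.mem_split`), and the generic driver **`deep test n B`** = `test B || (deep (n) left && deep (n) right)` with its soundness `SBox.forall_of_deep`:
  a leaf test sound on every box is sound after any bisection.
* §2 the three cell leaves built on `nestLeaf` / `pathLeaf` (`EmeryScaleLeverFI(Path)`): `easyLeaf` (base = anchor, move `+d`), `hardLeaf` (base = member
  `= anchor + s·d` formed inside the leaf, move `−d`), `pathLeafOn` (base = anchor, `t` at the `cP`-rows), and their pointwise meanings.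
* §3 **`cellCheck`** and its two readings **`upper_cell`** / **`lower_cell`**: for every anchor `A` in the family box, every `s` in the step cell, given the
  anchor window `ε_F(A, cN) ∈ W` (and, UPPER, a crude lower bound for the member), the composite comparison `T̃(M) ≤ T̃(A)` (resp. `≥`) of
  `EmeryScaleLeverSteps` together with the two-sided Fermi-energy enclosure of the member `ε_F(M, cN) ∈ [E_A + σ₁s, E_A + σ₂s]` that feeds the next stage.

Sources: three-band model [HybertsenSchluterChristensen1989, Eq. (1)]; energy-linearised one-band image [AndersenEtAl1995, §6]; interval arithmetic
[folklore] (Moore 1966).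
-/

noncomputable section

namespace Summit.Ventures.CertifiedManyBodySolver.Downfold.Emery

open Real Set Literature.Analysis.ValidatedNumerics.Numerics

/-! ## §1 Boxes and bisection -/

/-- A box in `(Δ, a, b, s, e)` with fixed-point interval coordinates. [folklore] -/
structure SBox where
  /-- charge-transfer energy of the anchor row -/
  iD : FI
  /-- `t_pd` of the anchor row -/
  iA : FI
  /-- `t_pp` of the anchor row -/
  iB : FI
  /-- step `s` along the move -/
  iS : FI
  /-- energy -/
  iE : FI

namespace SBox

/-- Lower half of an FI at the integer midpoint. [folklore] -/
def loHalf (I : FI) : FI := ⟨I.lo, (I.lo + I.hi) / 2⟩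

/-- Upper half of an FI at the integer midpoint. [folklore] -/
def hiHalf (I : FI) : FI := ⟨(I.lo + I.hi) / 2, I.hi⟩

/-- A member of `I` is in one of the two halves. [folklore] -/
theorem mem_halves {x : ℝ} {I : FI} (h : FI.mem x I) : FI.mem x (loHalf I) ∨ FI.mem x (hiHalf I) := by
  rcases le_total (x * SC) (((I.lo + I.hi) / 2 : ℤ) : ℝ) with hle | hle
  · exact Or.inl ⟨h.1, hle⟩
  · exact Or.inr ⟨hle, h.2⟩

/-- Replace coordinate `i` (0 … 4) by `f` of it. [folklore] -/
def mapDim (B : SBox) (i : ℕ) (f : FI → FI) : SBox :=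
  match i with
  | 0 => { B with iD := f B.iD }
  | 1 => { B with iA := f B.iA }
  | 2 => { B with iB := f B.iB }
  | 3 => { B with iS := f B.iS }
  | _ => { B with iE := f B.iE }

/-- Splitting coordinate `i` covers the box. [folklore] -/
theorem mem_split (B : SBox) (i : ℕ) {Δ a b s e : ℝ} (h : (FI.mem Δ B.iD ∧ FI.mem a B.iA ∧ FI.mem b B.iB ∧ FI.mem s B.iS ∧ FI.mem e B.iE)) :
    (FI.mem Δ (B.mapDim i loHalf).iD ∧ FI.mem a (B.mapDim i loHalf).iA ∧ FI.mem b (B.mapDim i loHalf).iB ∧ FI.mem s (B.mapDim i loHalf).iS ∧ FI.mem e (B.mapDim i loHalf).iE) ∨ (FI.mem Δ (B.mapDim i hiHalf).iD ∧ FI.mem a (B.mapDim i hiHalf).iA ∧ FI.mem b (B.mapDim i hiHalf).iB ∧ FI.mem s (B.mapDim i hiHalf).iS ∧ FI.mem e (B.mapDim i hiHalf).iE) := by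
  obtain ⟨h1, h2, h3, h4, h5⟩ := h
  match i with
  | 0 => rcases mem_halves h1 with h | h
         · exact Or.inl ⟨h, h2, h3, h4, h5⟩
         · exact Or.inr ⟨h, h2, h3, h4, h5⟩
  | 1 => rcases mem_halves h2 with h | h
         · exact Or.inl ⟨h1, h, h3, h4, h5⟩
         · exact Or.inr ⟨h1, h, h3, h4, h5⟩
  | 2 => rcases mem_halves h3 with h | h
         · exact Or.inl ⟨h1, h2, h, h4, h5⟩
         · exact Or.inr ⟨h1, h2, h, h4, h5⟩
  | 3 => rcases mem_halves h4 with h | h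
         · exact Or.inl ⟨h1, h2, h3, h, h5⟩
         · exact Or.inr ⟨h1, h2, h3, h, h5⟩
  | (n + 4) => rcases mem_halves h5 with h | h
               · exact Or.inl ⟨h1, h2, h3, h4, h⟩
               · exact Or.inr ⟨h1, h2, h3, h4, h⟩

/-- Width of coordinate `i`, weighted (the step coordinate counts 1/4). [folklore] -/
def width (B : SBox) (i : ℕ) : ℤ :=
  match i with
  | 0 => B.iD.hi - B.iD.lo
  | 1 => B.iA.hi - B.iA.lo
  | 2 => B.iB.hi - B.iB.lo
  | 3 => (B.iS.hi - B.iS.lo) / 4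
  | _ => B.iE.hi - B.iE.lo

/-- The coordinate to split: the widest (weighted). [folklore] -/
def widest (B : SBox) : ℕ :=
  let w0 := B.width 0
  let w1 := B.width 1
  let w2 := B.width 2
  let w3 := B.width 3
  let w4 := B.width 4
  let i01 := if w0 < w1 then 1 else 0
  let m01 := max w0 w1
  let i23 := if w2 < w3 then 3 else 2
  let m23 := max w2 w3
  let i03 := if m01 < m23 then i23 else i01
  let m03 := max m01 m23
  if m03 < w4 then 4 else i03

/-- **The bisection driver**: accept if the leaf test passes, else split the widest coordinate and recurse (depth `n`). [folklore] -/
def deep (test : SBox → Bool) : ℕ → SBox → Bool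
  | 0, B => test B
  | n + 1, B => test B || (deep test n (B.mapDim B.widest loHalf) && deep test n (B.mapDim B.widest hiHalf))

/-- **SOUNDNESS OF THE DRIVER**: a leaf test that is sound on every box stays sound after bisection. [folklore] -/
theorem forall_of_deep {test : SBox → Bool} {P : ℝ → ℝ → ℝ → ℝ → ℝ → Prop}
    (hsound : ∀ B : SBox, test B = true → ∀ Δ a b s e : ℝ, (FI.mem Δ B.iD ∧ FI.mem a B.iA ∧ FI.mem b B.iB ∧ FI.mem s B.iS ∧ FI.mem e B.iE) → P Δ a b s e) :
    ∀ (n : ℕ) (B : SBox), deep test n B = true → ∀ Δ a b s e : ℝ, (FI.mem Δ B.iD ∧ FI.mem a B.iA ∧ FI.mem b B.iB ∧ FI.mem s B.iS ∧ FI.mem e B.iE) → P Δ a b s e := by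
  intro n
  induction n with
  | zero => intro B h; exact hsound B h
  | succ n ih =>
    intro B h Δ a b s e hm
    simp only [deep, Bool.or_eq_true, Bool.and_eq_true] at h
    rcases h with h | ⟨hl, hr⟩
    · exact hsound B h Δ a b s e hm
    · rcases B.mem_split B.widest hm with hm' | hm'
      · exact ih _ hl Δ a b s e hm'
      · exact ih _ hr Δ a b s e hm'

end SBox

/-! ## §2 The cell leaves -/

/-- Move data of a cell: direction `(dΔ, da, db)` (thin FIs), the two pinned `t_pp′` values `cN` (rows whose Fermi energies are compared) and `cP`
(rows at which `t` is evaluated), and the three energy rates `σe` (easy nesting), `σh` (hard nesting), `σp` (path). [folklore] -/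
structure CellData where
  /-- direction, Δ component -/
  dD : FI
  /-- direction, `t_pd` component -/
  dA : FI
  /-- direction, `t_pp` component -/
  dB : FI
  /-- `t_pp′` of the nesting rows -/
  cN : FI
  /-- `t_pp′` of the path rows -/
  cP : FI
  /-- energy rate of the easy nesting pair -/
  sgE : FI
  /-- energy rate of the hard nesting pair -/
  sgH : FI
  /-- energy rate of the path pair -/
  sgP : FI

/-- Easy leaf: base = anchor `(Δ, a, b, cN)` at `e`, move `+d`, rate `σe`. [folklore] -/
def easyLeaf (cd : CellData) (B : SBox) : Bool :=
  nestLeaf B.iD B.iA B.iB cd.cN B.iE cd.dD cd.dA cd.dB (FI.ofInt 0) cd.sgE B.iS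

/-- Hard leaf: base = member `(Δ + s dΔ, a + s da, b + s db, cN)` at `e`, move `−d`, rate `σh`. [folklore] -/
def hardLeaf (cd : CellData) (B : SBox) : Bool :=
  nestLeaf (B.iD.add (B.iS.mul cd.dD)) (B.iA.add (B.iS.mul cd.dA)) (B.iB.add (B.iS.mul cd.dB)) cd.cN B.iE cd.dD.neg cd.dA.neg cd.dB.neg (FI.ofInt 0)
    cd.sgH B.iS

/-- Path leaf on the `cP`-rows: base = anchor at `e`, move `+d`, rate `σp`; `upper` selects the sign test. [folklore] -/
def pathLeafOn (upper : Bool) (cd : CellData) (B : SBox) : Bool :=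
  pathLeaf upper B.iD B.iA B.iB cd.cP B.iE cd.dD cd.dA cd.dB (FI.ofInt 0) cd.sgP B.iS

section Leaves

variable {cd : CellData} {dΔ da db cN cP σe σh σp : ℝ}

/-- Meaning of `easyLeaf`. [folklore] -/
theorem easyLeaf_sound (hcd : (FI.mem dΔ cd.dD ∧ FI.mem da cd.dA ∧ FI.mem db cd.dB ∧ FI.mem cN cd.cN ∧ FI.mem cP cd.cP ∧ FI.mem σe cd.sgE ∧ FI.mem σh cd.sgH ∧ FI.mem σp cd.sgP)) (B : SBox) (h : easyLeaf cd B = true) (Δ a b s e : ℝ) (hm : (FI.mem Δ B.iD ∧ FI.mem a B.iA ∧ FI.mem b B.iB ∧ FI.mem s B.iS ∧ FI.mem e B.iE)) :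
    ∀ x y : ℝ, x ∈ Icc (0 : ℝ) 1 → y ∈ Icc (0 : ℝ) 1 → 0 ≤ charCubic Δ a b cN x y e →
      0 ≤ charCubic (Δ + s * dΔ) (a + s * da) (b + s * db) cN x y (e + s * σe) := by
  intro x y hx hy hf
  obtain ⟨h1, h2, h3, h4, h5⟩ := hm
  obtain ⟨g1, g2, g3, g4, -, g6, -, -⟩ := hcd
  have h0 : FI.mem (0 : ℝ) (FI.ofInt 0) := by simpa using FI.mem_ofInt 0
  have := charCubic_transfer_of_nestLeaf h h1 h2 h3 g4 h5 g1 g2 g3 h0 g6 h4 hx hy hf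
  simpa using this

/-- Meaning of `hardLeaf`. [folklore] -/
theorem hardLeaf_sound (hcd : (FI.mem dΔ cd.dD ∧ FI.mem da cd.dA ∧ FI.mem db cd.dB ∧ FI.mem cN cd.cN ∧ FI.mem cP cd.cP ∧ FI.mem σe cd.sgE ∧ FI.mem σh cd.sgH ∧ FI.mem σp cd.sgP)) (B : SBox) (h : hardLeaf cd B = true) (Δ a b s e : ℝ) (hm : (FI.mem Δ B.iD ∧ FI.mem a B.iA ∧ FI.mem b B.iB ∧ FI.mem s B.iS ∧ FI.mem e B.iE)) :
    ∀ x y : ℝ, x ∈ Icc (0 : ℝ) 1 → y ∈ Icc (0 : ℝ) 1 → 0 ≤ charCubic (Δ + s * dΔ) (a + s * da) (b + s * db) cN x y e →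
      0 ≤ charCubic Δ a b cN x y (e + s * σh) := by
  intro x y hx hy hf
  obtain ⟨h1, h2, h3, h4, h5⟩ := hm
  obtain ⟨g1, g2, g3, g4, -, -, g7, -⟩ := hcd
  have h0 : FI.mem (0 : ℝ) (FI.ofInt 0) := by simpa using FI.mem_ofInt 0
  have m1 := FI.mem_add h1 (FI.mem_mul h4 g1)
  have m2 := FI.mem_add h2 (FI.mem_mul h4 g2)
  have m3 := FI.mem_add h3 (FI.mem_mul h4 g3)
  have := charCubic_transfer_of_nestLeaf h m1 m2 m3 g4 h5 (FI.mem_neg g1) (FI.mem_neg g2) (FI.mem_neg g3) h0 g7 h4 hx hy hf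
  simp only [mul_neg, mul_zero, add_zero] at this
  have e1 : Δ + s * dΔ + -(s * dΔ) = Δ := by ring
  have e2 : a + s * da + -(s * da) = a := by ring
  have e3 : b + s * db + -(s * db) = b := by ring
  rw [e1, e2, e3] at this
  exact this

/-- Meaning of `pathLeafOn true`. [folklore] -/
theorem pathLeafOn_upper_sound (hcd : (FI.mem dΔ cd.dD ∧ FI.mem da cd.dA ∧ FI.mem db cd.dB ∧ FI.mem cN cd.cN ∧ FI.mem cP cd.cP ∧ FI.mem σe cd.sgE ∧ FI.mem σh cd.sgH ∧ FI.mem σp cd.sgP)) (B : SBox) (h : pathLeafOn true cd B = true) (Δ a b s e : ℝ)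
    (hm : (FI.mem Δ B.iD ∧ FI.mem a B.iA ∧ FI.mem b B.iB ∧ FI.mem s B.iS ∧ FI.mem e B.iE)) :
    scaleNodeN (Δ + s * dΔ) (a + s * da) (b + s * db) cP (e + s * σp) / scaleNodeD (Δ + s * dΔ) (a + s * da) (b + s * db) cP (e + s * σp) ≤
      scaleNodeN Δ a b cP e / scaleNodeD Δ a b cP e := by
  obtain ⟨h1, h2, h3, h4, h5⟩ := hm
  obtain ⟨g1, g2, g3, -, g5, -, -, g8⟩ := hcd
  have h0 : FI.mem (0 : ℝ) (FI.ofInt 0) := by simpa using FI.mem_ofInt 0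
  have := scaleNode_le_of_pathLeaf h h1 h2 h3 g5 h5 g1 g2 g3 h0 g8 h4
  simpa using this

/-- Meaning of `pathLeafOn false`. [folklore] -/
theorem pathLeafOn_lower_sound (hcd : (FI.mem dΔ cd.dD ∧ FI.mem da cd.dA ∧ FI.mem db cd.dB ∧ FI.mem cN cd.cN ∧ FI.mem cP cd.cP ∧ FI.mem σe cd.sgE ∧ FI.mem σh cd.sgH ∧ FI.mem σp cd.sgP)) (B : SBox) (h : pathLeafOn false cd B = true) (Δ a b s e : ℝ)
    (hm : (FI.mem Δ B.iD ∧ FI.mem a B.iA ∧ FI.mem b B.iB ∧ FI.mem s B.iS ∧ FI.mem e B.iE)) :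
    scaleNodeN Δ a b cP e / scaleNodeD Δ a b cP e ≤
      scaleNodeN (Δ + s * dΔ) (a + s * da) (b + s * db) cP (e + s * σp) / scaleNodeD (Δ + s * dΔ) (a + s * da) (b + s * db) cP (e + s * σp) := by
  obtain ⟨h1, h2, h3, h4, h5⟩ := hm
  obtain ⟨g1, g2, g3, -, g5, -, -, g8⟩ := hcd
  have h0 : FI.mem (0 : ℝ) (FI.ofInt 0) := by simpa using FI.mem_ofInt 0
  have := scaleNode_ge_of_pathLeaf h h1 h2 h3 g5 h5 g1 g2 g3 h0 g8 h4
  simpa using this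

end Leaves

/-! ## §3 The cell check and its two readings -/

/-- `E ∈ [I.lo/SC, I.hi/SC] ⇒ E ∈ I`. [folklore] -/
theorem fimem_of_mem_Icc {E : ℝ} {I : FI} (h : E ∈ Icc ((I.lo : ℝ) / SC) ((I.hi : ℝ) / SC)) : FI.mem E I :=
  ⟨(div_le_iff₀ SC_pos).1 h.1, (le_div_iff₀ SC_pos).1 h.2⟩

/-- `E ∈ I ⇒ E ∈ [I.lo/SC, I.hi/SC]`. [folklore] -/
theorem mem_Icc_of_fimem {E : ℝ} {I : FI} (h : FI.mem E I) : E ∈ Icc ((I.lo : ℝ) / SC) ((I.hi : ℝ) / SC) :=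
  ⟨FI.lo_div_le h, FI.le_hi_div h⟩

/-- **`cellCheck`**: on the family box `F` (anchor coordinates `Δ, a, b`, the step cell `s`; the `e`-slot of `F` is the ANCHOR WINDOW `W`) and the
member window `Wh` (hard nesting): bisection (depth `n`) of the easy leaf over `W`, of the hard leaf over `Wh`, of the path leaf over `W`; the sign and
regime tests at the anchor and at the member `cP`-row; positivity of the shifted energies `W.lo + s·σ`. [folklore] -/
def cellCheck (upper : Bool) (cd : CellData) (n : ℕ) (F : SBox) (Wh : FI) : Bool :=
  let DM := F.iD.add (F.iS.mul cd.dD)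
  let AM := F.iA.add (F.iS.mul cd.dA)
  let BM := F.iB.add (F.iS.mul cd.dB)
  let etop : FI := if upper then thin Wh.hi else (thin F.iE.hi).add (F.iS.mul cd.sgP)
  SBox.deep (easyLeaf cd) n F && SBox.deep (hardLeaf cd) n { F with iE := Wh } && SBox.deep (pathLeafOn upper cd) n F &&
  decide (0 < F.iD.lo) && decide (0 < F.iA.lo) && decide (0 ≤ F.iB.lo) && decide (0 < DM.lo) && decide (0 < AM.lo) &&
  decide (0 ≤ cd.cP.lo) && decide (0 ≤ cd.cN.lo) && decide (0 ≤ (BM.sub cd.cP).lo) && decide (0 ≤ F.iS.lo) &&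
  decide ((cd.cP.mul etop).hi < (AM.sqr).lo) && decide ((BM.mul DM).hi < ((AM.sqr).mulInt 4).lo) &&
  decide (0 < ((thin F.iE.lo).add (F.iS.mul cd.sgP)).lo) && decide (0 < ((thin F.iE.lo).add (F.iS.mul cd.sgE)).lo) &&
  decide (0 < ((thin Wh.lo).add (F.iS.mul cd.sgH)).lo) && decide (0 < F.iE.lo) &&
  decide (((thin F.iE.hi).add (F.iS.mul cd.sgE)).hi ≤ Wh.hi) && decide (Wh.lo ≤ F.iE.lo)

section Cell

variable {cd : CellData} {dΔ da db cN cP : ℝ} {n : ℕ} {F : SBox} {Wh : FI}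

/-- The scalar part of `cellCheck`, read in `ℝ`. [folklore] -/
theorem cellCheck_scalars {upper : Bool} {σe σh σp : ℝ} (hcd : (FI.mem dΔ cd.dD ∧ FI.mem da cd.dA ∧ FI.mem db cd.dB ∧ FI.mem cN cd.cN ∧ FI.mem cP cd.cP ∧ FI.mem σe cd.sgE ∧ FI.mem σh cd.sgH ∧ FI.mem σp cd.sgP)) (h : cellCheck upper cd n F Wh = true)
    {Δ a b s : ℝ} (hD : FI.mem Δ F.iD) (hA : FI.mem a F.iA) (hB : FI.mem b F.iB) (hS : FI.mem s F.iS) :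
    SBox.deep (easyLeaf cd) n F = true ∧ SBox.deep (hardLeaf cd) n { F with iE := Wh } = true ∧ SBox.deep (pathLeafOn upper cd) n F = true ∧
    0 < Δ ∧ 0 < a ∧ 0 ≤ b ∧ 0 < Δ + s * dΔ ∧ 0 < a + s * da ∧ 0 ≤ cP ∧ 0 ≤ cN ∧ cP ≤ b + s * db ∧ 0 ≤ s ∧
    cP * (if upper then ((Wh.hi : ℝ) / SC) else ((F.iE.hi : ℝ) / SC + s * σp)) < (a + s * da) ^ 2 ∧ (b + s * db) * (Δ + s * dΔ) < 4 * (a + s * da) ^ 2 ∧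
    0 < (F.iE.lo : ℝ) / SC + s * σp ∧ 0 < (F.iE.lo : ℝ) / SC + s * σe ∧ 0 < (Wh.lo : ℝ) / SC + s * σh ∧ 0 < (F.iE.lo : ℝ) / SC ∧
    (F.iE.hi : ℝ) / SC + s * σe ≤ (Wh.hi : ℝ) / SC ∧ (Wh.lo : ℝ) / SC ≤ (F.iE.lo : ℝ) / SC := by
  obtain ⟨g1, g2, g3, g4, g5, g6, g7, g8⟩ := hcd
  unfold cellCheck at h
  simp only [Bool.and_eq_true, decide_eq_true_eq] at h
  obtain ⟨⟨⟨⟨⟨⟨⟨⟨⟨⟨⟨⟨⟨⟨⟨⟨⟨⟨⟨heasy, hhard⟩, hpath⟩, hD0⟩, hA0⟩, hB0⟩, hDM⟩, hAM⟩, hcP0⟩, hcN0⟩, hBMc⟩, hs0⟩, hregm⟩, hregq⟩, hpos1⟩, hpos2⟩, hpos3⟩,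
    hlo0⟩, hwin1⟩, hwin2⟩ := h
  have mDM := FI.mem_add hD (FI.mem_mul hS g1)
  have mAM := FI.mem_add hA (FI.mem_mul hS g2)
  have mBM := FI.mem_add hB (FI.mem_mul hS g3)
  have mlo : FI.mem ((F.iE.lo : ℝ) / SC) (thin F.iE.lo) := mem_thin _
  have mlo' : FI.mem ((Wh.lo : ℝ) / SC) (thin Wh.lo) := mem_thin _
  refine ⟨heasy, hhard, hpath, FI.pos_of_lo_pos hD hD0, FI.pos_of_lo_pos hA hA0, nonneg_of_lo_nonneg hB hB0, FI.pos_of_lo_pos mDM hDM,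
    FI.pos_of_lo_pos mAM hAM, nonneg_of_lo_nonneg g5 hcP0, nonneg_of_lo_nonneg g4 hcN0, ?_, nonneg_of_lo_nonneg hS hs0, ?_, ?_, ?_, ?_, ?_,
    div_pos (by exact_mod_cast hlo0) SC_pos, ?_, div_le_div_of_nonneg_right (by exact_mod_cast hwin2) SC_pos.le⟩
  · have := nonneg_of_lo_nonneg (FI.mem_sub mBM g5) hBMc; linarith
  · have metop : FI.mem (if upper then ((Wh.hi : ℝ) / SC) else ((F.iE.hi : ℝ) / SC + s * σp))
        (if upper then thin Wh.hi else (thin F.iE.hi).add (F.iS.mul cd.sgP)) := by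
      cases upper
      · simpa using FI.mem_add (mem_thin F.iE.hi) (FI.mem_mul hS g8)
      · simpa using mem_thin Wh.hi
    exact FI.lt_of_hi_lt_lo (FI.mem_mul g5 metop) (FI.mem_sqr mAM) hregm
  · have := FI.lt_of_hi_lt_lo (FI.mem_mul mBM mDM) (FI.mem_mulInt (FI.mem_sqr mAM) 4) hregq
    push_cast at this; linarith
  · exact FI.pos_of_lo_pos (FI.mem_add mlo (FI.mem_mul hS g8)) hpos1
  · exact FI.pos_of_lo_pos (FI.mem_add mlo (FI.mem_mul hS g6)) hpos2
  · exact FI.pos_of_lo_pos (FI.mem_add mlo' (FI.mem_mul hS g7)) hpos3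
  · have mhi : FI.mem ((F.iE.hi : ℝ) / SC) (thin F.iE.hi) := mem_thin _
    exact le_scaled_of_hi_le (FI.mem_add mhi (FI.mem_mul hS g6)) hwin1

/-- **THE UPPER CELL.** `cellCheck true` with rates `σe = −m`, `σh = ℓ`, `σp = −ℓ`: for every anchor `A = (Δ, a, b)` in the family box and every step `s`
in the cell, IF `ε_F(A, cN) ∈ W` and `ε_F(M, cN) ∈ Wh` (member `M = A + s·d`), THEN `t(M, cP; ε_F(M, cN)) ≤ t(A, cP; ε_F(A, cN))`,
`ε_F(A, cN) − ℓs ≤ ε_F(M, cN)` and `ε_F(M, cN) ≤ ε_F(A, cN) − ms`. [folklore] -/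
theorem upper_cell {m ℓ ν : ℝ} (hcd : (FI.mem dΔ cd.dD ∧ FI.mem da cd.dA ∧ FI.mem db cd.dB ∧ FI.mem cN cd.cN ∧ FI.mem cP cd.cP ∧ FI.mem (-m) cd.sgE ∧ FI.mem ℓ cd.sgH ∧ FI.mem (-ℓ) cd.sgP)) (hℓ0 : 0 ≤ ℓ) (hν0 : 0 < ν) (hν1 : ν < 1) (h : cellCheck true cd n F Wh = true)
    {Δ a b s : ℝ} (hD : FI.mem Δ F.iD) (hA : FI.mem a F.iA) (hB : FI.mem b F.iB) (hS : FI.mem s F.iS)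
    (hW : FI.mem (fermiEnergyOf Δ a b cN ν) F.iE) (hcrude : (Wh.lo : ℝ) / SC ≤ fermiEnergyOf (Δ + s * dΔ) (a + s * da) (b + s * db) cN ν) :
    scaleNodeN (Δ + s * dΔ) (a + s * da) (b + s * db) cP (fermiEnergyOf (Δ + s * dΔ) (a + s * da) (b + s * db) cN ν) /
        scaleNodeD (Δ + s * dΔ) (a + s * da) (b + s * db) cP (fermiEnergyOf (Δ + s * dΔ) (a + s * da) (b + s * db) cN ν) ≤
      scaleNodeN Δ a b cP (fermiEnergyOf Δ a b cN ν) / scaleNodeD Δ a b cP (fermiEnergyOf Δ a b cN ν) ∧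
    fermiEnergyOf Δ a b cN ν - ℓ * s ≤ fermiEnergyOf (Δ + s * dΔ) (a + s * da) (b + s * db) cN ν ∧
    fermiEnergyOf (Δ + s * dΔ) (a + s * da) (b + s * db) cN ν ≤ fermiEnergyOf Δ a b cN ν - m * s := by
  obtain ⟨heasy, hhard, hpath, HD, HA, HB, HDM, HAM, HcP, HcN, HBMc, Hs, Hregm, Hregq, Hpos1, Hpos2, -, -, Hwin1, -⟩ :=
    cellCheck_scalars hcd h hD hA hB hS
  simp only [↓reduceIte] at Hregm
  set EA := fermiEnergyOf Δ a b cN ν with hEA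
  set EM := fermiEnergyOf (Δ + s * dΔ) (a + s * da) (b + s * db) cN ν with hEM
  have hWI := mem_Icc_of_fimem hW
  -- (a) the easy nesting at E := E_A: ε_F(M) ≤ E_A − m s, hence ε_F(M) ∈ Wh
  have heasyE := SBox.forall_of_deep (easyLeaf_sound hcd) n F heasy Δ a b s EA ⟨hD, hA, hB, hS, hW⟩
  have hup : EM ≤ EA - m * s := by
    have hpos : 0 < EA + s * (-m) := by have := hWI.1; linarith
    have := fermiEnergyOf_le_of_transfer HD HA.ne' HcN HB HDM.le HcN (le_trans HcP HBMc) hν0 hν1 hpos heasyE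
    linarith
  have hWhI : EM ∈ Icc ((Wh.lo : ℝ) / SC) ((Wh.hi : ℝ) / SC) := ⟨hcrude, by have := hWI.2; nlinarith⟩
  -- (b) the step theorem
  have hstep := scaleNode_upper_step (cN := cN) (cP := cP) (ν := ν) (lo := (F.iE.lo : ℝ) / SC) (hi := (F.iE.hi : ℝ) / SC)
    (lc := (Wh.lo : ℝ) / SC) (hiM := (Wh.hi : ℝ) / SC) (ℓ := ℓ) (s := s) HD HB HDM HAM.ne' (le_trans HcP HBMc) HcN HcP HBMc hν0 hν1 hWI hWhI
    (mul_nonneg hℓ0 Hs) (by linarith) ?_ ?_ Hregm Hregq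
  · exact ⟨hstep.1, hstep.2, hup⟩
  · intro E hE x y hx hy hf
    have := SBox.forall_of_deep (hardLeaf_sound hcd) n { F with iE := Wh } hhard Δ a b s E ⟨hD, hA, hB, hS, fimem_of_mem_Icc hE⟩ x y hx hy hf
    simpa [mul_comm] using this
  · intro E hE
    have := SBox.forall_of_deep (pathLeafOn_upper_sound hcd) n F hpath Δ a b s E ⟨hD, hA, hB, hS, fimem_of_mem_Icc hE⟩
    have e1 : E + s * -ℓ = E - ℓ * s := by ring
    rw [e1] at this
    exact this

/-- **THE LOWER CELL.** `cellCheck false` with rates `σe = u`, `σh = −m`, `σp = u`: for every anchor `A` in the family box and every step `s` in the cell,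
IF `ε_F(A, cN) ∈ W` THEN `t(A, cP; ε_F(A, cN)) ≤ t(M, cP; ε_F(M, cN))` and `ε_F(M, cN) ≤ ε_F(A, cN) + us`; if moreover `ε_F(M, cN) ∈ Wh` then
`ε_F(A, cN) + ms ≤ ε_F(M, cN)`. [folklore] -/
theorem lower_cell {m u ν : ℝ} (hcd : (FI.mem dΔ cd.dD ∧ FI.mem da cd.dA ∧ FI.mem db cd.dB ∧ FI.mem cN cd.cN ∧ FI.mem cP cd.cP ∧ FI.mem u cd.sgE ∧ FI.mem (-m) cd.sgH ∧ FI.mem u cd.sgP)) (hu0 : 0 ≤ u) (hν0 : 0 < ν) (hν1 : ν < 1) (h : cellCheck false cd n F Wh = true)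
    {Δ a b s : ℝ} (hD : FI.mem Δ F.iD) (hA : FI.mem a F.iA) (hB : FI.mem b F.iB) (hS : FI.mem s F.iS)
    (hW : FI.mem (fermiEnergyOf Δ a b cN ν) F.iE) :
    (scaleNodeN Δ a b cP (fermiEnergyOf Δ a b cN ν) / scaleNodeD Δ a b cP (fermiEnergyOf Δ a b cN ν) ≤
      scaleNodeN (Δ + s * dΔ) (a + s * da) (b + s * db) cP (fermiEnergyOf (Δ + s * dΔ) (a + s * da) (b + s * db) cN ν) /
        scaleNodeD (Δ + s * dΔ) (a + s * da) (b + s * db) cP (fermiEnergyOf (Δ + s * dΔ) (a + s * da) (b + s * db) cN ν) ∧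
    fermiEnergyOf (Δ + s * dΔ) (a + s * da) (b + s * db) cN ν ≤ fermiEnergyOf Δ a b cN ν + u * s) ∧
    (fermiEnergyOf Δ a b cN ν ≤ fermiEnergyOf (Δ + s * dΔ) (a + s * da) (b + s * db) cN ν →
      fermiEnergyOf Δ a b cN ν + m * s ≤ fermiEnergyOf (Δ + s * dΔ) (a + s * da) (b + s * db) cN ν) := by
  obtain ⟨heasy, hhard, hpath, HD, HA, HB, HDM, HAM, HcP, HcN, HBMc, Hs, Hregm, Hregq, Hpos1, Hpos2, Hpos3, Hlo, Hwin1, Hwin2⟩ :=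
    cellCheck_scalars hcd h hD hA hB hS
  simp only [Bool.false_eq_true, ↓reduceIte] at Hregm
  set EA := fermiEnergyOf Δ a b cN ν with hEA
  set EM := fermiEnergyOf (Δ + s * dΔ) (a + s * da) (b + s * db) cN ν with hEM
  have hWI := mem_Icc_of_fimem hW
  have hstep := scaleNode_lower_step (cN := cN) (cP := cP) (ν := ν) (lo := (F.iE.lo : ℝ) / SC) (hi := (F.iE.hi : ℝ) / SC) (u := u) (s := s)
      HD HA.ne' HB HDM HAM.ne' (le_trans HcP HBMc) HcN HcP HBMc hν0 hν1 hWI Hlo (mul_nonneg hu0 Hs) ?_ ?_ ?_ Hregq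
  rotate_left
  · intro E hE x y hx hy hf
    have := SBox.forall_of_deep (easyLeaf_sound hcd) n F heasy Δ a b s E ⟨hD, hA, hB, hS, fimem_of_mem_Icc hE⟩ x y hx hy hf
    simpa [mul_comm] using this
  · intro E hE
    have := SBox.forall_of_deep (pathLeafOn_lower_sound hcd) n F hpath Δ a b s E ⟨hD, hA, hB, hS, fimem_of_mem_Icc hE⟩
    have e1 : E + s * u = E + u * s := by ring
    rw [e1] at this
    exact this
  · have e1 : (F.iE.hi : ℝ) / SC + s * u = (F.iE.hi : ℝ) / SC + u * s := by ring
    rw [e1] at Hregm; exact Hregm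
  refine ⟨hstep, ?_⟩
  intro hmono
  -- the member lies in Wh = [≤ W.lo, ≥ W.hi + u s]; hard nesting at E := E_M: ε_F(A) ≤ E_M − m s
  have hWh : FI.mem EM Wh := by
    refine fimem_of_mem_Icc ⟨?_, ?_⟩
    · exact Hwin2.trans (hWI.1.trans hmono)
    · have := hstep.2; have := hWI.2; nlinarith
  have hhardE := SBox.forall_of_deep (hardLeaf_sound hcd) n { F with iE := Wh } hhard Δ a b s EM ⟨hD, hA, hB, hS, hWh⟩
  have hWhI := mem_Icc_of_fimem hWh
  have hpos : 0 < EM + s * (-m) := by have := hWhI.1; linarith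
  have := fermiEnergyOf_le_of_transfer HDM HAM.ne' HcN (le_trans HcP HBMc) HD.le HcN HB hν0 hν1 hpos hhardE
  linarith

end Cell

end Summit.Ventures.CertifiedManyBodySolver.Downfold.Emery
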